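import Summits.QuantumAdvantage.QuantumAdvantage.Theorems.SosSandwichPseudoBoundedAABooleanCorner
import Summits.QuantumAdvantage.QuantumAdvantage.Theorems.SosSandwichTransferPBSimTreePB
import Summits.QuantumAdvantage.QuantumAdvantage.Theses.SosSandwich
import HarnessLib

/-!
# Crux `PseudoBoundedAA` (stmt-QuantumAdvantage-15237, route SosSandwich) — PB-AA ⟺ SHALLOW ROUNDING in the top band

Support file 3 (files 1–2: `SosSandwichPseudoBoundedAABooleanCornerOSSS.lean`, `SosSandwichPseudoBoundedAABooleanCorner.lean`).
The registered line `birth` of the crux lost its homogeneous rung on 2026-08-31 (`Theorems.SosSandwich.not_HomogeneousPBAA`;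
repaired item `HomogeneousPBAAT`, stmt-QuantumAdvantage-27399). This file certifies (complete proofs) a KERNEL EQUIVALENCE
giving the planner / lead an alternative one-stub line for the crux — the "rounding line":

  `PseudoBoundedAA  ⟺  RS`,   `RS := ∃ η > 0, ∃ c C > 0, ∀ N T p, 1 ≤ T → p ∈ K_T → Var[p] ≥ 1/4 − η →
                                     ∃ f : {0,1}^N → {0,1}, D(f) ≤ C·T^c ∧ 4·E(p − f)² ≤ Var[p]`

("every near-Boolean member of the sandwich class is within half a standard deviation, in `L²`, of a total Boolean
function of polynomial deterministic query complexity" — an AVERAGE-CASE analogue, for the two-sided SOS degree, of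
the tree's `D(f) ≤ bs·deg` / `D ≤ 4096 Q₂⁶`).

* `pseudoBoundedAA_of_shallowRounding` — `RS → PseudoBoundedAA` BY NAME: the robust Boolean corner
  (`BooleanCorner.exists_influence_ge_of_near_boolean`, pure OSSS: `4 Var² ≤ D(f)² · maxⱼ Infⱼ`) + the tree's
  top-band normal form `CornerLift.pseudoBoundedAA_of_topBand` (variance saturation inside `K`);
* `shallowRounding_of_pseudoBoundedAA` — `PseudoBoundedAA → RS` (`η = 1/512`, exponent `4c + 2`): run the
  Aaronson–Ambainis simulation tree under the PB-AA influence bound at order `2T` (tree theorem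
  `SimTreePB.simTree_depth_error_le_pb`: restrictions stay in `K`; accuracy `1/4` off a `1/64` fraction, depth
  `≤ K(512T+1)^{4c+2}`), threshold its leaves at `1/2` (`exists_decisionTree_threshold`), and bound the square loss
  pointwise by `(16/3)·p(1−p) + [bad]` (`sq_sub_round_le`), whose mean is `≤ (16/3)/512 + 1/64` in the top band
  (`nearCorner_of_topBand`);
* `pseudoBoundedAA_iff_shallowRounding` — the equivalence; `shallowRounding_of_boolean` — sanity on the exact corner.

Honest label: an EQUIVALENT reformulation of the crux (no stub is closed; the audit records
`pseudoBoundedAA_of_shallowRounding` as conditional). Its use: the crux is exactly the robustness, to `L²`-perturbation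
inside `K_T`, of the Boolean-corner theorem of file 2 (OSSS + Midrijanis), and a refuter may now attack PB-AA by ONE
near-Boolean `K_T` family that is `L²`-far from every shallow decision tree. No named fact; axioms standard.
Sources: O'Donnell–Saks–Schramm–Servedio, FOCS 2005, Thm 3.2; S. Aaronson, A. Ambainis, Theory Comput. 10 (2014),
Conj. 6 / Thm. 7 / Thm. 21; G. Midrijanis, arXiv:quant-ph/0403168, Thm 4.
-/

set_option linter.dupNamespace false

noncomputable section

namespace Summit.QuantumAdvantage.QuantumAdvantage.Theorems.SosSandwich

open Finset Function
open Literature.Computability.Complexity Literature.Computability.QuantumComplexity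
open Literature.Computability.QuantumComplexity.ClassicalSimulation
open Summit.QuantumAdvantage.QuantumAdvantage.Cruxes.TransferPB.Birth

namespace BooleanCorner

variable {N : ℕ}

/-! ### A rounding line for the crux: PB-AA ⟸ (top-band members of `K_T` are `L²`-close to shallow total Boolean functions) -/

/-- **The rounding line closes the crux.** HYPOTHESIS (the line's single open stub, "shallow rounding in the top
band"): for some absolute `η > 0`, `c`, `C > 0`, every `p ∈ K_T` (`T ≥ 1`) with `Var[p] ≥ 1/4 − η` is within a quarter
of its variance, in `L²`, of SOME total Boolean function `f` of deterministic query complexity `D(f) ≤ C·T^c`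
(`4·E(p − f)² ≤ Var[p]`). CONCLUSION: the route item `SosSandwich.PseudoBoundedAA` (stmt-QuantumAdvantage-15237)
itself — by the robust corner (`exists_influence_ge_of_near_boolean`: `4 Var² ≤ D(f)² · maxⱼ Infⱼ`, pure OSSS) and the
tree's top-band normal form `CornerLift.pseudoBoundedAA_of_topBand` (variance saturation inside `K`). The hypothesis
is implied by the Aaronson–Ambainis conjecture through classical simulation plus rounding, and holds trivially on the
exact Boolean corner (`shallowRounding_of_boolean`); it is NOT proved here (crux-strength).
[cite: OdonnellEtAl2005, Thm 3.2] [cite: AaronsonAmbainis2014, Conj. 6 and Thm. 7] -/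
theorem pseudoBoundedAA_of_shallowRounding
    (hRS : ∃ η : ℝ, 0 < η ∧ ∃ (c : ℕ) (C : ℝ), 0 < C ∧
      ∀ (N T : ℕ) (p : MvPolynomial (Fin N) ℝ), 1 ≤ T → PseudoBounded T p → 1 / 4 - η ≤ boolVariance p →
        ∃ f : (Fin N → Bool) → Bool, (detQueryComplexity f : ℝ) ≤ C * (T : ℝ) ^ c ∧
          4 * boolAvg (fun x => (evalBool p x - realOf f x) ^ 2) ≤ boolVariance p) :
    Summit.QuantumAdvantage.QuantumAdvantage.Theses.SosSandwich.PseudoBoundedAA := by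
  obtain ⟨η, hη, c, C, hC, hRS⟩ := hRS
  refine CornerLift.pseudoBoundedAA_of_topBand ⟨min η (1 / 8), lt_min hη (by norm_num), 2 * c,
    1 / (16 * C ^ 2), by positivity, ?_⟩
  intro N T p hT hp hv
  have hv' : 1 / 4 - η ≤ boolVariance p := le_trans (by linarith [min_le_left η (1 / 8)]) hv
  have hv8 : 1 / 8 ≤ boolVariance p := le_trans (by linarith [min_le_right η (1 / 8)]) hv
  have hvpos : 0 < boolVariance p := lt_of_lt_of_le (by norm_num) hv8
  obtain ⟨f, hD, happrox⟩ := hRS N T p hT hp hv'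
  obtain ⟨j, hj⟩ := exists_influence_ge_of_near_boolean p f happrox hvpos
  refine ⟨j, ?_⟩
  have hT1 : (1 : ℝ) ≤ T := by exact_mod_cast hT
  have hTc : (0 : ℝ) < (T : ℝ) ^ c := by positivity
  have hI := influence_nonneg j p
  have hD0 : (0 : ℝ) ≤ (detQueryComplexity f : ℝ) := by positivity
  -- `4 Var² ≤ D² Inf ≤ C² T^{2c} Inf` and `Var ≥ 1/8`
  have h1 : 4 * boolVariance p ^ 2 ≤ (C * (T : ℝ) ^ c) ^ 2 * influence j p := hj.trans (by gcongr)
  have h2 : 4 * (1 / 8 : ℝ) ^ 2 ≤ (C * (T : ℝ) ^ c) ^ 2 * influence j p :=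
    le_trans (by gcongr) h1
  rw [div_le_iff₀ (by positivity : (0 : ℝ) < (T : ℝ) ^ (2 * c))]
  have hpow : (T : ℝ) ^ (2 * c) = ((T : ℝ) ^ c) ^ 2 := by rw [pow_mul']
  rw [hpow]
  have hCT : (0 : ℝ) < C ^ 2 * ((T : ℝ) ^ c) ^ 2 := by positivity
  have h3 : 1 / 16 ≤ C ^ 2 * ((T : ℝ) ^ c) ^ 2 * influence j p := by nlinarith
  calc 1 / (16 * C ^ 2) = (1 / 16) / C ^ 2 := by rw [div_div]
    _ ≤ (C ^ 2 * ((T : ℝ) ^ c) ^ 2 * influence j p) / C ^ 2 := by gcongr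
    _ = influence j p * ((T : ℝ) ^ c) ^ 2 := by field_simp

/-- **Sanity: the rounding hypothesis holds on the exact Boolean corner** — a `{0,1}`-valued member of `K_T` is its
own rounding, with `D ≤ 32 T³` (`detQueryComplexity_le_of_pseudoBounded`) and `L²`-distance `0`. [folklore] -/
theorem shallowRounding_of_boolean {T : ℕ} {p : MvPolynomial (Fin N) ℝ} (hp : PseudoBounded T p)
    (hbool : ∀ x, evalBool p x = 0 ∨ evalBool p x = 1) :
    ∃ f : (Fin N → Bool) → Bool, (detQueryComplexity f : ℝ) ≤ 32 * (T : ℝ) ^ 3 ∧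
      4 * boolAvg (fun x => (evalBool p x - realOf f x) ^ 2) ≤ boolVariance p := by
  classical
  set f : (Fin N → Bool) → Bool := fun x => decide (evalBool p x = 1) with hf
  have hpf : ∀ x, evalBool p x = realOf f x := by
    intro x
    rw [realOf_apply]
    rcases hbool x with h0 | h1
    · rw [h0]; simp [hf, h0]
    · rw [h1]; simp [hf, h1]
  refine ⟨f, by exact_mod_cast detQueryComplexity_le_of_pseudoBounded hp f hpf, ?_⟩
  have h0 : boolAvg (fun x => (evalBool p x - realOf f x) ^ 2) = 0 := by
    unfold boolAvg
    rw [Finset.sum_eq_zero fun x _ => by rw [hpf x, sub_self]; ring, zero_div]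
  rw [h0, mul_zero]
  exact boolVariance_nonneg p

/-! ### The converse: PB-AA gives shallow rounding in the top band (so the rounding stub is crux-EQUIVALENT) -/

/-- Thresholding the leaves of a real decision tree at `1/2` gives a Boolean decision tree of no larger depth computing
`x ↦ [t(x) ≥ 1/2]`. [folklore] -/
theorem exists_decisionTree_threshold (t : RealDecisionTree N) :
    ∃ T' : DecisionTree N, T'.depth ≤ t.depth ∧ ∀ x, T'.eval x = decide ((1 : ℝ) / 2 ≤ t.eval x) := by
  induction t with
  | leaf r => exact ⟨DecisionTree.leaf (decide ((1 : ℝ) / 2 ≤ r)), le_rfl, fun x => rfl⟩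
  | query i t₀ t₁ ih₀ ih₁ =>
    obtain ⟨T₀, hd₀, he₀⟩ := ih₀
    obtain ⟨T₁, hd₁, he₁⟩ := ih₁
    refine ⟨DecisionTree.query i T₀ T₁, ?_, fun x => ?_⟩
    · simp only [DecisionTree.depth, RealDecisionTree.depth]
      exact Nat.add_le_add_right (max_le_max hd₀ hd₁) 1
    · simp only [DecisionTree.eval, RealDecisionTree.eval]
      split_ifs with hx
      · exact he₁ x
      · exact he₀ x

/-- Rounding a `1/4`-accurate estimate of a number `p ∈ [0,1]` costs at most `(16/3)·p(1−p)` in square loss: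
`(p − [t ≥ 1/2])² ≤ (16/3)·p(1−p)` whenever `|t − p| ≤ 1/4`. [folklore] -/
theorem sq_sub_round_le {p t : ℝ} (h0 : 0 ≤ p) (h1 : p ≤ 1) (ht : |t - p| ≤ 1 / 4) :
    (p - (if (1 : ℝ) / 2 ≤ t then 1 else 0)) ^ 2 ≤ 16 / 3 * (p * (1 - p)) := by
  rw [abs_le] at ht
  obtain ⟨ht1, ht2⟩ := ht
  split_ifs with hr
  · have hp : 1 / 4 ≤ p := by linarith
    nlinarith [mul_nonneg (sub_nonneg.mpr h1) (by linarith : (0 : ℝ) ≤ 19 / 3 * p - 1)]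
  · have hp : p ≤ 3 / 4 := by linarith
    nlinarith [mul_nonneg h0 (by linarith : (0 : ℝ) ≤ 16 / 3 - 19 / 3 * p)]

/-- **PB-AA ⟹ shallow rounding in the top band** (`η = 1/512`, exponent `4c+2`): granted the crux, every
`p ∈ K_T` with `Var[p] ≥ 1/4 − 1/512` is within a quarter of its variance, in `L²`, of the total Boolean function
`[p̃ ≥ 1/2]`, where `p̃` is the Aaronson–Ambainis simulation tree of `p` (accuracy `1/4` off a `1/64` fraction of the
cube, depth `poly(T)`; tree theorem `SimTreePB.simTree_depth_error_le_pb` run with the PB-AA influence bound at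
order `2T`, restrictions staying in `K`), so `D([p̃ ≥ 1/2]) ≤ K·(513 T)^{4c+2}`; the square loss is
`≤ (16/3)·E[p(1−p)] + 1/64 ≤ (16/3)/512 + 1/64 < (1/4 − 1/512)/4` by `nearCorner_of_topBand`. Together with
`pseudoBoundedAA_of_shallowRounding`: the rounding stub is EQUIVALENT to the crux. [cite: AaronsonAmbainis2014, Thm. 21 (proof)]
[cite: OdonnellEtAl2005, Thm 3.2] -/
theorem shallowRounding_of_pseudoBoundedAA
    (hPB : Summit.QuantumAdvantage.QuantumAdvantage.Theses.SosSandwich.PseudoBoundedAA) :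
    ∃ η : ℝ, 0 < η ∧ ∃ (c : ℕ) (C : ℝ), 0 < C ∧
      ∀ (N T : ℕ) (p : MvPolynomial (Fin N) ℝ), 1 ≤ T → PseudoBounded T p → 1 / 4 - η ≤ boolVariance p →
        ∃ f : (Fin N → Bool) → Bool, (detQueryComplexity f : ℝ) ≤ C * (T : ℝ) ^ c ∧
          4 * boolAvg (fun x => (evalBool p x - realOf f x) ^ 2) ≤ boolVariance p := by
  classical
  have hAA : ∃ (c : ℕ) (C : ℝ), 0 < C ∧ ∀ (N T : ℕ) (p : MvPolynomial (Fin N) ℝ) (ε : ℝ), 1 ≤ T →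
      PseudoBounded T p → 0 < ε → ε ≤ boolVariance p → ∃ i : Fin N, C * (ε / T) ^ c ≤ influence i p := hPB
  obtain ⟨c, C, hC, hAA⟩ := hAA
  set K : ℝ := ((Nat.ceil (16 * 2 ^ c * 2 ^ c / C) + 1 : ℕ) : ℝ) with hK
  have hK0 : 0 < K := by rw [hK]; positivity
  refine ⟨1 / 512, by norm_num, 4 * c + 2, K * 513 ^ (4 * c + 2), by positivity, ?_⟩
  intro N T p hT hp hv
  -- a representative of total degree `≤ 2T`
  obtain ⟨P, hPdeg, hPp⟩ := exists_totalDegree_le_of_pseudoBounded hp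
  have hKP : PseudoBounded T P := hp.of_eval_eq fun x => hPp x
  have hd1 : 1 ≤ 2 * T := by omega
  have hTd : T ≤ 2 * T := by omega
  -- PB-AA at order `2T` is the class hypothesis of the simulation theorem
  have H : ∀ (q : MvPolynomial (Fin N) ℝ) (ε : ℝ), PseudoBounded (2 * T) q → 0 < ε → ε ≤ boolVariance q →
      ∃ i : Fin N, C * (ε / ((2 * T : ℕ) : ℝ)) ^ c ≤ influence i q :=
    fun q ε hq hε hεv => hAA N (2 * T) q ε hd1 hq hε hεv
  have hsim := SimTreePB.simTree_depth_error_le_pb hC hd1 hTd H hKP hPdeg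
    (ε := 1 / 4) (δ := 1 / 64) (by norm_num) (by norm_num) (by norm_num) (by norm_num)
  obtain ⟨t, hdepth, herr⟩ : ∃ t : RealDecisionTree N,
      (t.depth : ℝ) ≤ ((Nat.ceil (16 * 2 ^ c * 2 ^ c / C) + 1 : ℕ) : ℝ) *
          (((2 * T : ℕ) : ℝ) / (1 / 4 * (1 / 64)) + 1) ^ (4 * c + 2) ∧
        ((Finset.univ.filter fun x : Fin N → Bool => (1 / 4 : ℝ) < |t.eval x - evalBool P x|).card : ℝ)
          ≤ 1 / 64 * 2 ^ N :=
    ⟨_, hsim.1, hsim.2⟩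
  -- the rounded tree
  obtain ⟨T', hT'd, hT'e⟩ := exists_decisionTree_threshold t
  refine ⟨fun x => decide ((1 : ℝ) / 2 ≤ t.eval x), ?_, ?_⟩
  · -- depth: `D(f) ≤ depth T' ≤ depth t ≤ K (512 T + 1)^{4c+2} ≤ K 513^{4c+2} T^{4c+2}`
    have h1 : (detQueryComplexity (fun x => decide ((1 : ℝ) / 2 ≤ t.eval x)) : ℝ) ≤ (t.depth : ℝ) := by
      exact_mod_cast (detQueryComplexity_le_depth T' (fun x => hT'e x)).trans hT'd
    refine h1.trans (hdepth.trans ?_)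
    have hT1 : (1 : ℝ) ≤ T := by exact_mod_cast hT
    have h2 : ((2 * T : ℕ) : ℝ) / (1 / 4 * (1 / 64)) + 1 ≤ 513 * (T : ℝ) := by
      have e : ((2 * T : ℕ) : ℝ) / (1 / 4 * (1 / 64)) = 512 * (T : ℝ) := by
        rw [div_eq_iff (by norm_num : (1 : ℝ) / 4 * (1 / 64) ≠ 0)]
        push_cast; ring
      rw [e]; linarith
    have h3 : (((2 * T : ℕ) : ℝ) / (1 / 4 * (1 / 64)) + 1) ^ (4 * c + 2) ≤ (513 * (T : ℝ)) ^ (4 * c + 2) :=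
      pow_le_pow_left₀ (by positivity) h2 _
    rw [← hK]
    calc K * (((2 * T : ℕ) : ℝ) / (1 / 4 * (1 / 64)) + 1) ^ (4 * c + 2) ≤ K * (513 * (T : ℝ)) ^ (4 * c + 2) := by
          gcongr
      _ = K * 513 ^ (4 * c + 2) * (T : ℝ) ^ (4 * c + 2) := by rw [mul_pow]; ring
  · -- square loss: pointwise `(p − f)² ≤ (16/3) p(1−p) + [x bad]`
    set bad : Finset (Fin N → Bool) :=
      Finset.univ.filter fun x : Fin N → Bool => (1 / 4 : ℝ) < |t.eval x - evalBool P x| with hbad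
    have hpt : ∀ x : Fin N → Bool,
        (evalBool p x - realOf (fun x => decide ((1 : ℝ) / 2 ≤ t.eval x)) x) ^ 2
          ≤ 16 / 3 * (evalBool p x * (1 - evalBool p x)) + (if x ∈ bad then 1 else 0) := by
      intro x
      have h0 : 0 ≤ evalBool p x := hp.eval_nonneg x
      have h1 : evalBool p x ≤ 1 := hp.eval_le_one x
      have hreal : realOf (fun x => decide ((1 : ℝ) / 2 ≤ t.eval x)) x = if (1 : ℝ) / 2 ≤ t.eval x then 1 else 0 := by
        rw [realOf_apply]
        by_cases h : (1 : ℝ) / 2 ≤ t.eval x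
        · rw [if_pos h, if_pos (decide_eq_true h)]
        · rw [if_neg h, if_neg (by simpa using h)]
      rw [hreal]
      by_cases hx : x ∈ bad
      · rw [if_pos hx]
        have hpp : 0 ≤ evalBool p x * (1 - evalBool p x) := mul_nonneg h0 (by linarith)
        have hsq : (evalBool p x - (if (1 : ℝ) / 2 ≤ t.eval x then 1 else 0)) ^ 2 ≤ 1 := by
          split_ifs <;> nlinarith
        linarith
      · rw [if_neg hx, add_zero]
        have hgood : |t.eval x - evalBool p x| ≤ 1 / 4 := by
          rw [← hPp x]
          by_contra hlt
          exact hx (by rw [hbad, Finset.mem_filter]; exact ⟨Finset.mem_univ _, not_le.mp hlt⟩)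
        exact sq_sub_round_le h0 h1 hgood
    -- sum the pointwise bound
    have h2N : (0 : ℝ) < (2 : ℝ) ^ N := by positivity
    have hnear := (nearCorner_of_topBand hp hv).1
    have hsum : ∑ x, (evalBool p x - realOf (fun x => decide ((1 : ℝ) / 2 ≤ t.eval x)) x) ^ 2
        ≤ 16 / 3 * ∑ x, (evalBool p x * (1 - evalBool p x)) + (bad.card : ℝ) := by
      calc _ ≤ ∑ x, (16 / 3 * (evalBool p x * (1 - evalBool p x)) + (if x ∈ bad then (1 : ℝ) else 0)) :=
            Finset.sum_le_sum fun x _ => hpt x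
        _ = 16 / 3 * ∑ x, (evalBool p x * (1 - evalBool p x)) + (bad.card : ℝ) := by
            rw [Finset.sum_add_distrib, ← Finset.mul_sum, Finset.sum_ite_mem, Finset.univ_inter,
              Finset.sum_const, nsmul_eq_mul, mul_one]
    have hcorner : ∑ x, (evalBool p x * (1 - evalBool p x)) ≤ (2 : ℝ) ^ N * (1 / 512) := by
      have := hnear
      unfold boolAvg at this
      rwa [div_le_iff₀ h2N, mul_comm] at this
    have hbadc : (bad.card : ℝ) ≤ 1 / 64 * 2 ^ N := herr
    have hE : boolAvg (fun x => (evalBool p x - realOf (fun x => decide ((1 : ℝ) / 2 ≤ t.eval x)) x) ^ 2)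
        ≤ 16 / 3 * (1 / 512) + 1 / 64 := by
      unfold boolAvg
      rw [div_le_iff₀ h2N]
      nlinarith [hsum, hcorner, hbadc, h2N]
    nlinarith [hE, hv]

/-- **KERNEL EQUIVALENCE: PB-AA ⟺ shallow rounding in the top band.** The rank-2 crux `SosSandwich.PseudoBoundedAA`
holds iff, for some absolute `η > 0`, `c`, `C > 0`, every pseudo-bounded `p` of order `T ≥ 1` with `Var[p] ≥ 1/4 − η`
is within a quarter of its variance (in `L²`) of a total Boolean function of deterministic query complexity
`≤ C·T^c` — an average-case analogue, for the two-sided SOS degree, of `D(f) ≤ bs(f)·deg(f)` / `D ≤ 4096 Q₂⁶`.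
[cite: OdonnellEtAl2005, Thm 3.2] [cite: AaronsonAmbainis2014, Conj. 6, Thm. 7 and Thm. 21] [cite: Midrijanis2004, Thm 4] -/
theorem pseudoBoundedAA_iff_shallowRounding :
    Summit.QuantumAdvantage.QuantumAdvantage.Theses.SosSandwich.PseudoBoundedAA ↔
      ∃ η : ℝ, 0 < η ∧ ∃ (c : ℕ) (C : ℝ), 0 < C ∧
        ∀ (N T : ℕ) (p : MvPolynomial (Fin N) ℝ), 1 ≤ T → PseudoBounded T p → 1 / 4 - η ≤ boolVariance p →
          ∃ f : (Fin N → Bool) → Bool, (detQueryComplexity f : ℝ) ≤ C * (T : ℝ) ^ c ∧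
            4 * boolAvg (fun x => (evalBool p x - realOf f x) ^ 2) ≤ boolVariance p :=
  ⟨shallowRounding_of_pseudoBoundedAA, pseudoBoundedAA_of_shallowRounding⟩

end BooleanCorner

end Summit.QuantumAdvantage.QuantumAdvantage.Theorems.SosSandwich

end
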